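import Summits.HodgeConjecture.HodgeConjecture.Theses.EndoscopicMiddleDegree
import Literature.AlgebraicGeometry.ShimuraVarieties.SpecialCycleClasses

/-!
# `MiddleThetaSpan` (stmt-HodgeConjecture-13661) · Negative · the `m = 0` calibration is Lefschetz (1,1)

Negative knowledge for the crux `EndoscopicMiddleDegree.MiddleThetaSpan` (route
EndoscopicMiddleDegree, rank 2), about its guard `1 ≤ m`: the SAME sentence at `m = 0` (compact Picard
modular surfaces, `p = 2`) is EQUIVALENT to Lefschetz (1,1) on those surfaces
(`atZero_iff_lefschetz`). `⇐`: `SC⁰ = H⁰ ∋ 1` (`specialCycleClasses_zero`) and `1 ∪ d = d`, so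
summand 2 alone swallows every divisor class. `⇒`: in this degree all three summands consist of
classes supported in codimension `≥ 1` unconditionally (`SC¹ ≤ N¹`; `H⁰ ∪ N¹ ⊆ N¹` needs no moving
lemma). So at `m = 0` the crux has no theta content, and the Blasius–Rogawski classes (rational
`(1,1)`-classes that are not special, zbl:0828.14012) are absorbed by the PRODUCT summand — the guard
`1 ≤ m` is not where that phenomenon is excluded; at `m = 1` the only absorber left is `NS · NS`
(disprover's work file `Cruxes/MiddleThetaSpan/Disproof.lean`, F4). Refuter seat
refuter-cdisprove-stmt-HodgeConjecture-13661-g2-0 (cdisprove cycle 2), 2026-08-16; mathematics of cycle 1.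
-/

noncomputable section

-- The mandated namespace `Summit.<P>.<Sub>.Theorems.…` repeats `HodgeConjecture` (single-conjunct summit).
set_option linter.dupNamespace false

namespace Summit.HodgeConjecture.HodgeConjecture.Theorems.MiddleThetaSpan.Negative.AtZeroLefschetz

open Literature.AlgebraicGeometry Literature.AlgebraicGeometry.HodgeTheory
  Literature.AlgebraicGeometry.ShimuraVarieties Literature.AlgebraicTopology.SingularHomology

variable {p : ℕ} {X : Motives.SchemeOver ℂ}

/-- Any class cupped with a class supported on a Zariski-closed `Z` is supported on `Z`.
[cite: Fulton1998, §19.2 Cor. 19.2] -/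
theorem cup_mem_classesSupportedOn_right {Z : Set X.left} (hZ : IsClosed Z) {i j n : ℕ}
    (h : i + j = n) (s : complexBetti X i) {d : complexBetti X j}
    (hd : d ∈ classesSupportedOn X Z j) : cupProduct h s d ∈ classesSupportedOn X Z n := by
  have hs : s ∈ classesSupportedOn X Set.univ i := by
    rw [classesSupportedOn_univ]; exact Submodule.mem_top
  simpa only [Set.univ_inter] using cupProduct_mem_classesSupportedOn_inter isClosed_univ hZ h hs hd

/-- Any class cupped with a class supported in codimension `≥ r` is supported in codimension `≥ r`
(`H ∪ NʳH ⊆ Nʳ`; in particular `H⁰ ∪ N¹H² ⊆ N¹H²`). [cite: GrothendieckTopology1969, §1] -/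
theorem cup_mem_supportedClasses_right {i j n : ℕ} (h : i + j = n) (s : complexBetti X i)
    {r : ℕ} {d : complexBetti X j} (hd : d ∈ supportedClasses X j r) :
    cupProduct h s d ∈ supportedClasses X n r := by
  have key : supportedClasses X j r ≤ (supportedClasses X n r).comap (cupProduct h s) :=
    supportedClasses_le fun Z hZ hr d hd ↦ by
      rw [Submodule.mem_comap]
      exact classesSupportedOn_le_supportedClasses hZ hr n
        (cup_mem_classesSupportedOn_right hZ h s (mem_classesSupportedOn_iff.mpr
          (LinearMap.mem_ker.mp hd)))
  exact key hd

/-- **The `m = 0` calibration.** The crux's sentence at `m = 0` (guard removed; special-cycle spans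
written as in the route file) holds for every compact arithmetic 2-ball quotient iff Lefschetz (1,1)
holds for them (rational `(1,1)`-classes are algebraic). [cite: VoisinHodgeI2002, Thm. 11.30] -/
theorem atZero_iff_lefschetz :
    (∀ (X : Motives.SchemeOver ℂ) (D : UnitaryBallQuotientDatum (2 * (0 + 1)) X)
      (c : complexBetti X (2 * (0 + 1))), IsRationalClass c →
        IsOfHodgeType (2 * (0 + 1)) X (2 * (0 + 1)) (0 + 1) (0 + 1) c →
          c ∈ (⨆ (W : Submodule D.E (Fin (2 * (0 + 1) + 1) → D.E))
              (_ : IsTotallyPositive (conjRingHom D.E) D.H W) (_ : Module.finrank D.E W = 0 + 1),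
              classesSupportedOn X (D.specialSubvariety W) (2 * (0 + 1))) ⊔
            Submodule.span ℂ {z : complexBetti X (2 * (0 + 1)) |
              ∃ s ∈ (⨆ (W : Submodule D.E (Fin (2 * (0 + 1) + 1) → D.E))
                (_ : IsTotallyPositive (conjRingHom D.E) D.H W) (_ : Module.finrank D.E W = 0),
                classesSupportedOn X (D.specialSubvariety W) (2 * 0)),
              ∃ d ∈ algebraicClasses X 1, z = cupProduct (two_mul_add_two_mul 0 1) s d} ⊔
            Submodule.span ℂ {z : complexBetti X (2 * (0 + 1)) |
              ∃ a : complexBetti X (2 * 0), IsRationalClass a ∧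
                IsOfHodgeType (2 * (0 + 1)) X (2 * 0) 0 0 a ∧
                  ∃ d ∈ algebraicClasses X 1, z = cupProduct (two_mul_add_two_mul 0 1) a d}) ↔
    (∀ (X : Motives.SchemeOver ℂ), Nonempty (UnitaryBallQuotientDatum (2 * (0 + 1)) X) →
      ∀ c : complexBetti X (2 * 1), IsRationalClass c →
        IsOfHodgeType (2 * (0 + 1)) X (2 * 1) 1 1 c → c ∈ algebraicClasses X 1) := by
  constructor
  · rintro h0 X ⟨D⟩ c hc hH
    obtain ⟨y, hy, w, hw, rfl⟩ := Submodule.mem_sup.1 (h0 X D c hc hH)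
    obtain ⟨u, hu, v, hv, rfl⟩ := Submodule.mem_sup.1 hy
    refine add_mem (add_mem ?_ ?_) ?_
    · exact specialCycleClasses_le_algebraicClasses D (0 + 1) hu
    · refine (Submodule.span_le.2 ?_) hv
      rintro z ⟨s, -, d, hd, rfl⟩
      exact cup_mem_supportedClasses_right _ s hd
    · refine (Submodule.span_le.2 ?_) hw
      rintro z ⟨a, -, -, d, hd, rfl⟩
      exact cup_mem_supportedClasses_right _ a hd
  · intro hL X D c hc hH
    have hca : c ∈ algebraicClasses X 1 := hL X ⟨D⟩ c hc hH
    refine Submodule.mem_sup_left (Submodule.mem_sup_right (Submodule.subset_span ?_))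
    refine ⟨singularCohomology.one ℂ (Motives.ComplexPoints X), ?_, c, hca, ?_⟩
    · change _ ∈ specialCycleClasses D 0
      rw [specialCycleClasses_zero]; exact Submodule.mem_top
    · exact (one_cupProduct c).symm

end Summit.HodgeConjecture.HodgeConjecture.Theorems.MiddleThetaSpan.Negative.AtZeroLefschetz

end
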